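import Summits.ValiantsHypothesis.ValiantsHypothesis.Theorems.BarrierLeverChowThinRowsSubcube
import Summits.ValiantsHypothesis.ValiantsHypothesis.Theorems.BarrierLeverChowThinSeparatingReduction

/-!
# Route BarrierLever — item `ChowHitsThinRowPartitionMinors` (stmt-ValiantsHypothesis-20195):
# TWIN PEELING for the first-order-rows slice, I — the one-coordinate lifting step

Helper file (`--supports stmt-ValiantsHypothesis-20195`; cell valiant-natproofs, rung V4, 𝒟-side of
door (c); prover seat valiant-natproofs-prover gen 11).  Closes NO item; imports only the prover-g10
sub-cube slice `…ChowThinRowsSubcube` and seat val-np-p7's `…ChowThinSeparatingReduction` (no route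
file).  Companions: `…ChowThinRowsTwinPeelForms` (base + recursion) and `…ChowThinRowsTwinPeel` (the
matrix assembly and the slice theorem).

Conventions of items 19717 / 20172 / 20195: `x_a = X (castAdd h a)`, `y_c = X (natAdd h c)` in
`MvPolynomial (Fin (h+h)) ℂ`; the partition-matrix entry of `f` at `(u, w)` is `coeff (E u w) f`,
`E u w = Σ_{a ∈ u} single (castAdd h a) 1 + Σ_{c ∈ w} single (natAdd h c) 1`.

THE OBJECT.  For a finite family `𝒦` of subsets `V ⊆ Fin h` let `φ⁰_V = 1 + Σ_{c ∈ V} y_c` be the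
`x`-free INDICATOR FORM (written, as in `…ChowThinRowsSubcubePrelims`, with the zero `x`-part
`Σ_a C 0 · x_a`, so that prover g10's lemmas apply verbatim), `B_𝒦 = ∏_{V ∈ 𝒦} φ⁰_V`, and
`E_V = ∏_{V' ∈ 𝒦, V' ≠ V} φ⁰_{V'}` the leave-one-out products.  For a column family `𝒲` the two
properties that drive the first-order-rows slice of item 20195 are
* SPAN(𝒦, 𝒲): the vectors `(coeff_{y^W} E_V)_{W ∈ 𝒲}`, `V ∈ 𝒦`, span `ℂ^𝒲`
  (every target `g` on `𝒲` is `Σ_V c_V · coeff_{y^W} E_V`) — with generic `x`-parts the singleton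
  rows of the partition matrix are generic combinations of these vectors;
* POS(𝒦, 𝒲): `coeff_{y^W} B_𝒦 ≠ 0` for every `W ∈ 𝒲` (the `∅`-row).

THE MOVE (`span_insert_singleton`, `pos_insert_singleton`).  Let `c` be a coordinate with AT MOST ONE
TWIN PAIR in `𝒲` — at most one `W ∈ 𝒲` with `c ∉ W` and `W ∪ {c} ∈ 𝒲` (hypothesis: every such `W`
equals a given `w₀`).  If `𝒦'` avoids `c` and has SPAN and POS for the peeled columns
`{W \ {c} : W ∈ 𝒲}`, then `𝒦 = {{c}} ∪ 𝒦'` (one more form `1 + y_c`) has SPAN and POS for `𝒲`: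
on squarefree monomials `(1 + y_c) · P` at `W` equals `P` at `W \ {c}` (val-np-p7's
`coeff_partitionExpo_oneAddY_mul`), so the leave-one-out vectors of `𝒦'` lift to the functions on `𝒲`
that are constant on the fibres of `W ↦ W \ {c}`, and the one new vector `E_{{c}} = B_{𝒦'}`
vanishes exactly on the columns containing `c` (`coeff_looProd_insert_singleton_self`), hence
separates the (at most one) twin pair; the coefficient of the new form is
`(g(w₀) - g(w₀ ∪ {c})) / B_{𝒦'}(w₀)`.  Zero twins is val-np-p7's separating reduction
`chow_hit_of_separating`; ONE twin is the new lever — it is what makes affinely DEPENDENT column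
families reachable from the down-closed base (affinely independent families have every coordinate
in at most one twin pair; two twin pairs `{W, W ∪ c}, {W', W' ∪ c}` are an affine circuit).

WHAT THIS IS NOT: no statement about columns whose every coordinate carries two twin pairs (the
«2-thick core» of planner g14's MEMO-thinrows §9, e.g. two squares glued at a vertex); nothing on
rows of size 2, on items 20195 / 20172 / 19717 themselves, on crux stmt-ValiantsHypothesis-14610, or
on `VP` versus `VNP`.
-/

set_option linter.dupNamespace false

namespace Summit.ValiantsHypothesis.ValiantsHypothesis.Theorems.BarrierLever.ChowTwinPeel

open Finset MvPolynomial
open Summit.ValiantsHypothesis.ValiantsHypothesis.Theorems.BarrierLever.ChowSubcube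
  (coeff_empty_prod_eq coeff_empty_prod_nat leaveOneOut_independent_of_downClosed)
open Summit.ValiantsHypothesis.ValiantsHypothesis.Theorems.BarrierLever.ChowThinAffine
  (coeff_partitionExpo_oneAddY_mul)
open Summit.ValiantsHypothesis.ValiantsHypothesis.Theorems.BarrierLever.ProductStateSums
  (castAdd_ne_natAdd partitionExpo_apply_natAdd)

variable {h : ℕ}

/-! ## 1. The indicator form of a singleton and `c`-free products -/

/-- The `x`-free indicator form of the singleton `{c}` is the single form `1 + y_c`. -/
theorem form0_singleton (c : Fin h) :
    (C 1 + ∑ a, C ((fun (_ : Fin h) (_ : Finset (Fin h)) => (0 : ℂ)) a {c}) * X (Fin.castAdd h a) +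
      ∑ c', C (if c' ∈ ({c} : Finset (Fin h)) then (1 : ℂ) else 0) * X (Fin.natAdd h c') :
        MvPolynomial (Fin (h + h)) ℂ) = C 1 + X (Fin.natAdd h c) := by
  have h1 : ∑ a : Fin h, C ((fun (_ : Fin h) (_ : Finset (Fin h)) => (0 : ℂ)) a {c}) *
      X (Fin.castAdd h a) = (0 : MvPolynomial (Fin (h + h)) ℂ) := by
    refine Finset.sum_eq_zero fun a _ => ?_
    simp
  have h2 : ∑ c', C (if c' ∈ ({c} : Finset (Fin h)) then (1 : ℂ) else 0) * X (Fin.natAdd h c') =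
      (X (Fin.natAdd h c) : MvPolynomial (Fin (h + h)) ℂ) := by
    rw [Finset.sum_eq_single c]
    · simp
    · intro c' _ hc'
      rw [if_neg (by simpa using hc'), C_0, zero_mul]
    · intro hc; exact absurd (Finset.mem_univ c) hc
  rw [h1, h2, add_zero]

/-- An indicator form `φ⁰_V` with `c ∉ V` does not involve the variable `y_c`. -/
theorem natAdd_not_mem_vars_form0 (V : Finset (Fin h)) (c : Fin h) (hc : c ∉ V) :
    Fin.natAdd h c ∉ (C 1 + ∑ a, C ((fun (_ : Fin h) (_ : Finset (Fin h)) => (0 : ℂ)) a V) *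
      X (Fin.castAdd h a) + ∑ c', C (if c' ∈ V then (1 : ℂ) else 0) * X (Fin.natAdd h c') :
        MvPolynomial (Fin (h + h)) ℂ).vars := by
  classical
  have h1 : ∑ a : Fin h, C ((fun (_ : Fin h) (_ : Finset (Fin h)) => (0 : ℂ)) a V) *
      X (Fin.castAdd h a) = (0 : MvPolynomial (Fin (h + h)) ℂ) := by
    refine Finset.sum_eq_zero fun a _ => ?_
    simp
  rw [h1, add_zero]
  intro hv
  rcases Finset.mem_union.mp (vars_add_subset _ _ hv) with hv1 | hv2
  · rw [vars_C] at hv1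
    exact Finset.notMem_empty _ hv1
  · have hv3 := vars_sum_subset _ _ hv2
    rw [Finset.mem_biUnion] at hv3
    obtain ⟨c', _, hc'⟩ := hv3
    by_cases hcV : c' ∈ V
    · rw [if_pos hcV, C_1, one_mul, vars_X, Finset.mem_singleton] at hc'
      exact hc ((Fin.natAdd_injective _ _ hc') ▸ hcV)
    · rw [if_neg hcV, C_0, zero_mul, vars_0] at hc'
      exact Finset.notMem_empty _ hc'

/-- A product of indicator forms over a family avoiding `c` does not involve `y_c`. -/
theorem natAdd_not_mem_vars_prod (𝒦 : Finset (Finset (Fin h))) (c : Fin h)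
    (hfree : ∀ V ∈ 𝒦, c ∉ V) :
    Fin.natAdd h c ∉ (∏ V ∈ 𝒦, (C 1 + ∑ a, C ((fun (_ : Fin h) (_ : Finset (Fin h)) => (0 : ℂ)) a V) *
      X (Fin.castAdd h a) + ∑ c', C (if c' ∈ V then (1 : ℂ) else 0) * X (Fin.natAdd h c') :
        MvPolynomial (Fin (h + h)) ℂ)).vars := by
  classical
  intro hv
  have hv' := vars_prod _ hv
  rw [Finset.mem_biUnion] at hv'
  obtain ⟨V, hV, hvV⟩ := hv'
  exact natAdd_not_mem_vars_form0 V c (hfree V hV) hvV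

/-- A polynomial avoiding `y_c` has zero coefficient at every `y^W` with `c ∈ W`. -/
theorem coeff_eq_zero_of_natAdd_not_mem_vars (f : MvPolynomial (Fin (h + h)) ℂ) (c : Fin h)
    (hf : Fin.natAdd h c ∉ f.vars) (W : Finset (Fin h)) (hcW : c ∈ W) :
    coeff (∑ a ∈ (∅ : Finset (Fin h)), Finsupp.single (Fin.castAdd h a) 1 +
        ∑ c' ∈ W, Finsupp.single (Fin.natAdd h c') 1) f = 0 := by
  classical
  by_contra hne
  apply hf
  rw [mem_vars_iff_mem_support]
  refine ⟨_, mem_support_iff.mpr hne, ?_⟩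
  rw [Finsupp.mem_support_iff, partitionExpo_apply_natAdd, if_pos hcW]
  exact one_ne_zero

/-! ## 2. Inserting the single form `1 + y_c` in front of a `c`-free family -/

/-- The singleton `{c}` is not a member of a family avoiding `c`. -/
theorem singleton_not_mem_of_free (𝒦 : Finset (Finset (Fin h))) (c : Fin h)
    (hfree : ∀ V ∈ 𝒦, c ∉ V) : ({c} : Finset (Fin h)) ∉ 𝒦 :=
  fun hc => hfree {c} hc (Finset.mem_singleton_self c)

/-- **Full product after inserting `1 + y_c`**: on squarefree monomials,
`coeff_{y^W} B_{{c} ∪ 𝒦'} = coeff_{y^{W \ c}} B_{𝒦'}` for a `c`-free family `𝒦'`. -/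
theorem coeff_prod_insert_singleton (𝒦 : Finset (Finset (Fin h))) (c : Fin h)
    (hfree : ∀ V ∈ 𝒦, c ∉ V) (W : Finset (Fin h)) :
    coeff (∑ a ∈ (∅ : Finset (Fin h)), Finsupp.single (Fin.castAdd h a) 1 +
        ∑ c' ∈ W, Finsupp.single (Fin.natAdd h c') 1)
      (∏ V ∈ insert ({c} : Finset (Fin h)) 𝒦, (C 1 + ∑ a, C ((fun (_ : Fin h) (_ : Finset (Fin h)) =>
        (0 : ℂ)) a V) * X (Fin.castAdd h a) + ∑ c', C (if c' ∈ V then (1 : ℂ) else 0) * X (Fin.natAdd h c') :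
        MvPolynomial (Fin (h + h)) ℂ)) =
    coeff (∑ a ∈ (∅ : Finset (Fin h)), Finsupp.single (Fin.castAdd h a) 1 +
        ∑ c' ∈ W.erase c, Finsupp.single (Fin.natAdd h c') 1)
      (∏ V ∈ 𝒦, (C 1 + ∑ a, C ((fun (_ : Fin h) (_ : Finset (Fin h)) =>
        (0 : ℂ)) a V) * X (Fin.castAdd h a) + ∑ c', C (if c' ∈ V then (1 : ℂ) else 0) * X (Fin.natAdd h c') :
        MvPolynomial (Fin (h + h)) ℂ)) := by
  classical
  rw [Finset.prod_insert (singleton_not_mem_of_free 𝒦 c hfree), form0_singleton]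
  exact coeff_partitionExpo_oneAddY_mul _ c (natAdd_not_mem_vars_prod 𝒦 c hfree) ∅ W

/-- **Leave-one-out products after inserting `1 + y_c`, old forms**: for `V ∈ 𝒦'`,
`coeff_{y^W} E_V^{{c} ∪ 𝒦'} = coeff_{y^{W \ c}} E_V^{𝒦'}`. -/
theorem coeff_looProd_insert_singleton_of_mem (𝒦 : Finset (Finset (Fin h))) (c : Fin h)
    (hfree : ∀ V ∈ 𝒦, c ∉ V) (V : Finset (Fin h)) (hV : V ∈ 𝒦) (W : Finset (Fin h)) :
    coeff (∑ a ∈ (∅ : Finset (Fin h)), Finsupp.single (Fin.castAdd h a) 1 +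
        ∑ c' ∈ W, Finsupp.single (Fin.natAdd h c') 1)
      (∏ V' ∈ (insert ({c} : Finset (Fin h)) 𝒦).erase V, (C 1 + ∑ a, C ((fun (_ : Fin h)
        (_ : Finset (Fin h)) => (0 : ℂ)) a V') * X (Fin.castAdd h a) +
        ∑ c', C (if c' ∈ V' then (1 : ℂ) else 0) * X (Fin.natAdd h c') : MvPolynomial (Fin (h + h)) ℂ)) =
    coeff (∑ a ∈ (∅ : Finset (Fin h)), Finsupp.single (Fin.castAdd h a) 1 +
        ∑ c' ∈ W.erase c, Finsupp.single (Fin.natAdd h c') 1)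
      (∏ V' ∈ 𝒦.erase V, (C 1 + ∑ a, C ((fun (_ : Fin h) (_ : Finset (Fin h)) =>
        (0 : ℂ)) a V') * X (Fin.castAdd h a) + ∑ c', C (if c' ∈ V' then (1 : ℂ) else 0) * X (Fin.natAdd h c') :
        MvPolynomial (Fin (h + h)) ℂ)) := by
  classical
  have hne : V ≠ {c} := fun e => hfree V hV (e ▸ Finset.mem_singleton_self c)
  rw [Finset.erase_insert_of_ne (Ne.symm hne)]
  exact coeff_prod_insert_singleton (𝒦.erase V) c (fun V' hV' => hfree V' (Finset.mem_of_mem_erase hV')) W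

/-- **The new leave-one-out product** `E_{{c}}^{{c} ∪ 𝒦'} = B_{𝒦'}`: its coefficient at `y^W` is
that of `B_{𝒦'}`, and it VANISHES when `c ∈ W`. -/
theorem coeff_looProd_insert_singleton_self (𝒦 : Finset (Finset (Fin h))) (c : Fin h)
    (hfree : ∀ V ∈ 𝒦, c ∉ V) (W : Finset (Fin h)) :
    coeff (∑ a ∈ (∅ : Finset (Fin h)), Finsupp.single (Fin.castAdd h a) 1 +
        ∑ c' ∈ W, Finsupp.single (Fin.natAdd h c') 1)
      (∏ V' ∈ (insert ({c} : Finset (Fin h)) 𝒦).erase {c}, (C 1 + ∑ a, C ((fun (_ : Fin h)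
        (_ : Finset (Fin h)) => (0 : ℂ)) a V') * X (Fin.castAdd h a) +
        ∑ c', C (if c' ∈ V' then (1 : ℂ) else 0) * X (Fin.natAdd h c') : MvPolynomial (Fin (h + h)) ℂ)) =
    if c ∈ W then 0 else
      coeff (∑ a ∈ (∅ : Finset (Fin h)), Finsupp.single (Fin.castAdd h a) 1 +
          ∑ c' ∈ W, Finsupp.single (Fin.natAdd h c') 1)
        (∏ V' ∈ 𝒦, (C 1 + ∑ a, C ((fun (_ : Fin h) (_ : Finset (Fin h)) =>
          (0 : ℂ)) a V') * X (Fin.castAdd h a) + ∑ c', C (if c' ∈ V' then (1 : ℂ) else 0) * X (Fin.natAdd h c') :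
          MvPolynomial (Fin (h + h)) ℂ)) := by
  classical
  rw [Finset.erase_insert (singleton_not_mem_of_free 𝒦 c hfree)]
  split_ifs with hcW
  · exact coeff_eq_zero_of_natAdd_not_mem_vars _ c (natAdd_not_mem_vars_prod 𝒦 c hfree) W hcW
  · rfl

/-! ## 3. The twin-peeling step: SPAN and POS lift from `{W \ c}` to `𝒲` -/

/-- **POS lifts.** -/
theorem pos_insert_singleton (𝒦 : Finset (Finset (Fin h))) (c : Fin h)
    (hfree : ∀ V ∈ 𝒦, c ∉ V) (𝒲 : Finset (Finset (Fin h)))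
    (hpos : ∀ W ∈ 𝒲, coeff (∑ a ∈ (∅ : Finset (Fin h)), Finsupp.single (Fin.castAdd h a) 1 +
        ∑ c' ∈ W.erase c, Finsupp.single (Fin.natAdd h c') 1)
      (∏ V ∈ 𝒦, (C 1 + ∑ a, C ((fun (_ : Fin h) (_ : Finset (Fin h)) =>
        (0 : ℂ)) a V) * X (Fin.castAdd h a) + ∑ c', C (if c' ∈ V then (1 : ℂ) else 0) * X (Fin.natAdd h c') :
        MvPolynomial (Fin (h + h)) ℂ)) ≠ 0) :
    ∀ W ∈ 𝒲, coeff (∑ a ∈ (∅ : Finset (Fin h)), Finsupp.single (Fin.castAdd h a) 1 +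
        ∑ c' ∈ W, Finsupp.single (Fin.natAdd h c') 1)
      (∏ V ∈ insert ({c} : Finset (Fin h)) 𝒦, (C 1 + ∑ a, C ((fun (_ : Fin h) (_ : Finset (Fin h)) =>
        (0 : ℂ)) a V) * X (Fin.castAdd h a) + ∑ c', C (if c' ∈ V then (1 : ℂ) else 0) * X (Fin.natAdd h c') :
        MvPolynomial (Fin (h + h)) ℂ)) ≠ 0 := by
  intro W hW
  rw [coeff_prod_insert_singleton 𝒦 c hfree W]
  exact hpos W hW

/-- **SPAN lifts (the twin-peeling step).**  Hypotheses: `𝒦'` avoids `c`; every `W ∈ 𝒲` with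
`c ∉ W` and `W ∪ {c} ∈ 𝒲` equals `w₀` (at most one twin pair along `c`); POS and SPAN for `𝒦'` on the
peeled columns `W \ c`, `W ∈ 𝒲`.  Conclusion: SPAN for `{{c}} ∪ 𝒦'` on `𝒲`.  The coefficient of the new
form is `a = (g(w₀) - g(w₀ ∪ c)) / B_{𝒦'}(w₀)`; the old forms represent the fibre-constant remainder. -/
theorem span_insert_singleton (𝒦 : Finset (Finset (Fin h))) (c : Fin h)
    (hfree : ∀ V ∈ 𝒦, c ∉ V) (𝒲 : Finset (Finset (Fin h))) (w₀ : Finset (Fin h))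
    (htwin : ∀ W ∈ 𝒲, c ∉ W → insert c W ∈ 𝒲 → W = w₀)
    (hpos : ∀ W ∈ 𝒲, coeff (∑ a ∈ (∅ : Finset (Fin h)), Finsupp.single (Fin.castAdd h a) 1 +
        ∑ c' ∈ W.erase c, Finsupp.single (Fin.natAdd h c') 1)
      (∏ V ∈ 𝒦, (C 1 + ∑ a, C ((fun (_ : Fin h) (_ : Finset (Fin h)) =>
        (0 : ℂ)) a V) * X (Fin.castAdd h a) + ∑ c', C (if c' ∈ V then (1 : ℂ) else 0) * X (Fin.natAdd h c') :
        MvPolynomial (Fin (h + h)) ℂ)) ≠ 0)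
    (hspan : ∀ g : Finset (Fin h) → ℂ, ∃ cV : Finset (Fin h) → ℂ, ∀ W ∈ 𝒲,
      ∑ V ∈ 𝒦, cV V * coeff (∑ a ∈ (∅ : Finset (Fin h)), Finsupp.single (Fin.castAdd h a) 1 +
          ∑ c' ∈ W.erase c, Finsupp.single (Fin.natAdd h c') 1)
        (∏ V' ∈ 𝒦.erase V, (C 1 + ∑ a, C ((fun (_ : Fin h) (_ : Finset (Fin h)) =>
          (0 : ℂ)) a V') * X (Fin.castAdd h a) + ∑ c', C (if c' ∈ V' then (1 : ℂ) else 0) *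
          X (Fin.natAdd h c') : MvPolynomial (Fin (h + h)) ℂ)) = g (W.erase c)) :
    ∀ g : Finset (Fin h) → ℂ, ∃ cV : Finset (Fin h) → ℂ, ∀ W ∈ 𝒲,
      ∑ V ∈ insert ({c} : Finset (Fin h)) 𝒦, cV V *
        coeff (∑ a ∈ (∅ : Finset (Fin h)), Finsupp.single (Fin.castAdd h a) 1 +
          ∑ c' ∈ W, Finsupp.single (Fin.natAdd h c') 1)
        (∏ V' ∈ (insert ({c} : Finset (Fin h)) 𝒦).erase V, (C 1 + ∑ a, C ((fun (_ : Fin h)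
          (_ : Finset (Fin h)) => (0 : ℂ)) a V') * X (Fin.castAdd h a) +
          ∑ c', C (if c' ∈ V' then (1 : ℂ) else 0) * X (Fin.natAdd h c') : MvPolynomial (Fin (h + h)) ℂ)) =
      g W := by
  classical
  intro g
  -- the full product of the old forms, on squarefree monomials
  set B : Finset (Fin h) → ℂ := fun W' => coeff (∑ a ∈ (∅ : Finset (Fin h)),
      Finsupp.single (Fin.castAdd h a) 1 + ∑ c' ∈ W', Finsupp.single (Fin.natAdd h c') 1)
    (∏ V ∈ 𝒦, (C 1 + ∑ a, C ((fun (_ : Fin h) (_ : Finset (Fin h)) =>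
      (0 : ℂ)) a V) * X (Fin.castAdd h a) + ∑ c', C (if c' ∈ V then (1 : ℂ) else 0) * X (Fin.natAdd h c') :
      MvPolynomial (Fin (h + h)) ℂ)) with hB
  -- the coefficient of the new form and the corrected target on the peeled columns
  set a : ℂ := if (w₀ ∈ 𝒲 ∧ c ∉ w₀ ∧ insert c w₀ ∈ 𝒲) then (g w₀ - g (insert c w₀)) / B w₀ else 0
    with ha
  set g' : Finset (Fin h) → ℂ := fun W' =>
    if (insert c W' ∈ 𝒲 ∧ c ∉ W') then g (insert c W') else g W' - a * B W' with hg'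
  obtain ⟨cV', hcV'⟩ := hspan g'
  refine ⟨fun V => if V = {c} then a else cV' V, fun W hW => ?_⟩
  rw [Finset.sum_insert (singleton_not_mem_of_free 𝒦 c hfree)]
  dsimp only
  rw [if_pos rfl, coeff_looProd_insert_singleton_self 𝒦 c hfree W]
  have hrest : ∑ V ∈ 𝒦, (if V = {c} then a else cV' V) *
      coeff (∑ a ∈ (∅ : Finset (Fin h)), Finsupp.single (Fin.castAdd h a) 1 +
          ∑ c' ∈ W, Finsupp.single (Fin.natAdd h c') 1)
        (∏ V' ∈ (insert ({c} : Finset (Fin h)) 𝒦).erase V, (C 1 + ∑ a, C ((fun (_ : Fin h)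
          (_ : Finset (Fin h)) => (0 : ℂ)) a V') * X (Fin.castAdd h a) +
          ∑ c', C (if c' ∈ V' then (1 : ℂ) else 0) * X (Fin.natAdd h c') : MvPolynomial (Fin (h + h)) ℂ)) =
      g' (W.erase c) := by
    rw [← hcV' W hW]
    refine Finset.sum_congr rfl fun V hV => ?_
    have hne : V ≠ {c} := fun e => hfree V hV (e ▸ Finset.mem_singleton_self c)
    rw [if_neg hne, coeff_looProd_insert_singleton_of_mem 𝒦 c hfree V hV W]
  rw [hrest]
  by_cases hcW : c ∈ W
  · -- a column containing `c`: the new form contributes nothing, `g'` reads `g` off the twin above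
    rw [if_pos hcW, mul_zero, zero_add, hg']
    dsimp only
    rw [Finset.insert_erase hcW, if_pos ⟨hW, Finset.notMem_erase c W⟩]
  · rw [if_neg hcW, Finset.erase_eq_of_notMem hcW, hg']
    dsimp only
    by_cases htw : insert c W ∈ 𝒲
    · -- the twin pair: `W = w₀`
      have hW0 : W = w₀ := htwin W hW hcW htw
      rw [if_pos ⟨htw, hcW⟩, ha, if_pos ⟨hW0 ▸ hW, hW0 ▸ hcW, hW0 ▸ htw⟩, ← hW0]
      have hBW : B W ≠ 0 := by
        have := hpos W hW
        rwa [Finset.erase_eq_of_notMem hcW] at this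
      field_simp
      ring
    · rw [if_neg (fun h' => htw h'.1)]
      ring

end Summit.ValiantsHypothesis.ValiantsHypothesis.Theorems.BarrierLever.ChowTwinPeel
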